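import Summits.QuantumFields.BalabanUV.T4Continuum.Support.NE7EtaLogSlack
import Mathlib.Analysis.SpecialFunctions.Pow.Real
import HarnessLib

/-!
# NE7CovGradBootstrapAlgebra — supplier stub (S-g′) of the NE7 crux, part 2 (ROAD-G108 §1–§2): THE REAL ARITHMETIC OF THE COVARIANT-GRADIENT BOOTSTRAP —
# a cube root, the sublinear absorption `l³ = 2cG ∧ G ≤ K l² + R ⟹ G ≤ 16c²K³ + 2R`, and the exchange of the junction logarithm `(1+k)` against spare powers of `θ`

Cell `pub-balaban`, rung (B)+1 sub-cell t4, lineage `b2b-balaban-t4-ne7-p1`, generation 108 (CRUX PROVER NE7 #1 = OWNER of BINDER row NE7).  Memo `t4/b2b-balaban-t4-ne7-p1-g108/ROAD-G108.md` §1–§2.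
WHY.  The weak socket `h_w` asks `G := max‖∇_W X‖ ≤ Λ_G θ^{38k}` for the pair coordinate `X` of adjacent-level minimisers.  The slice part's curved C¹ letter (`NE7CurvedGradLetterUniform`) charges
`K_G(1 + log M)·sup‖curl_W X‖`, and `sup‖curl_W X‖ ≤ 8l₂²γθ^{42k}` (`NE7EtaRatesD4Cov.norm_curl_le_rate_cov`) needs the curl's Lipschitz letter `Λ₂ξ³ ≤ l₂³ξ³`, where (S-b)
(`NE7CurlGradientReading.norm_curlGrad_le_of_radii`) gives `Λ₂ = Λ₂⁰ + c·G` with `c = 128·C_Sε·M²` — the bootstrap quantity enters through a CUBE ROOT only.  Either `cG ≤ l₀³` (then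
`l₂ := 2l₀` and the bound is direct) or `l₂³ := 2cG` and `G ≤ K l₂² + R` gives `G ≤ 16c²K³ + 2R` (`caseB_bound`); the logarithm `(1+k)` costs one power of `θ` (`NE7EtaLogSlack`).
WHAT ([folklore]; 0 def, 0 sorry).  `exists_cube_root`, **`caseB_bound`**, `one_add_mul_pow_le`, `pow_le_pow_mul_of_le`, **`rate_caseA`**, **`rate_caseB`**, **`rate_normal`** — every term of the
final bound is `≤ (k-free constant)·θ^{38k}`; §3 (appended, gen 108 log-tolerant supplier): the parametric twins `rate_caseA_le` (`b ≤ 41`), `rate_caseB_le` (`b ≤ 51`), `rate_normal_le`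
(`b ≤ 54`) and `sq_two_add_rate` (`A(2+k)²θ^{40k} ≤ 4AD²θ^{38k}`).
HONEST FRAMING (page 1): elementary real analysis; nothing of Bałaban's asserted; nothing of NE3∕NE7 discharged; spine count = dagwriter∕referees' call; FIXED FINITE T⁴,
rung (B)+1 — NOT infinite volume, NOT mass gap, NOT BetaPertH, NOT Clay.
-/

set_option autoImplicit false

namespace Summit.QuantumFields.BalabanUV.T4Continuum.NE7CovGradBootstrapAlgebra

open NE7EtaLogSlack (succ_mul_pow_le)

/-! ## §1 The cube root and the sublinear absorption -/

/-- Every positive real has a positive cube root. [folklore] -/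
theorem exists_cube_root {t : ℝ} (ht : 0 < t) : ∃ l : ℝ, 0 < l ∧ l ^ 3 = t := by
  refine ⟨t ^ ((1 : ℝ) / 3), Real.rpow_pos_of_pos ht _, ?_⟩
  rw [← Real.rpow_natCast, ← Real.rpow_mul ht.le]
  norm_num

/-- **THE SUBLINEAR ABSORPTION**: `0 < c`, `0 ≤ K, R`, `0 < l`, `l³ = 2cG`, `G ≤ K l² + R` ⟹ `G ≤ 16c²K³ + 2R`
(if `l ≤ 4cK` then `G ≤ K(4cK)² + R`; else `l − 2cK ≥ l∕2`, so `l³∕2 ≤ l²(l − 2cK) = 2cG − 2cK l² ≤ 2cR`, i.e. `G ≤ 2R`). [folklore] -/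
theorem caseB_bound {G c K R l : ℝ} (hc : 0 < c) (hK : 0 ≤ K) (hR : 0 ≤ R) (hl : 0 < l)
    (hl3 : l ^ 3 = 2 * c * G) (hGle : G ≤ K * l ^ 2 + R) : G ≤ 16 * c ^ 2 * K ^ 3 + 2 * R := by
  have hcK : 0 ≤ c * K := mul_nonneg hc.le hK
  have h16 : 0 ≤ 16 * c ^ 2 * K ^ 3 := by positivity
  rcases le_or_gt l (4 * c * K) with hle | hlt
  · -- `l² ≤ (4cK)²`
    have hl2 : l ^ 2 ≤ (4 * c * K) ^ 2 := pow_le_pow_left₀ hl.le hle 2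
    have : K * l ^ 2 ≤ K * (4 * c * K) ^ 2 := mul_le_mul_of_nonneg_left hl2 hK
    nlinarith
  · -- `l > 4cK`: `l²·(l/2) ≤ l²(l − 2cK) = l³ − 2cK l² ≤ 2cR`
    have hl2 : 0 < l ^ 2 := by positivity
    have h1 : l ^ 3 ≤ 2 * c * (K * l ^ 2 + R) := by rw [hl3]; exact mul_le_mul_of_nonneg_left hGle (by positivity)
    have h2 : l ^ 2 * (l / 2) ≤ l ^ 2 * (l - 2 * c * K) := mul_le_mul_of_nonneg_left (by linarith) hl2.le
    have h3 : l ^ 3 ≤ 4 * c * R := by nlinarith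
    have h4 : 2 * c * G ≤ 2 * c * (2 * R) := by rw [← hl3]; linarith
    have h5 : G ≤ 2 * R := le_of_mul_le_mul_left h4 (by positivity)
    linarith

/-! ## §2 The logarithm against spare powers of `θ` -/

/-- `(1 + k)·θ^k ≤ (1 − θ)⁻¹` for `0 ≤ θ < 1`. [folklore] -/
theorem one_add_mul_pow_le {θ : ℝ} (h0 : 0 ≤ θ) (h1 : θ < 1) (k : ℕ) : (1 + (k : ℝ)) * θ ^ k ≤ (1 - θ)⁻¹ := by
  rw [add_comm]; exact succ_mul_pow_le h0 h1 k

/-- `θ^{a·k} ≤ θ^{b·k}` for `b ≤ a`, `0 ≤ θ ≤ 1`. [folklore] -/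
theorem pow_le_pow_mul_of_le {θ : ℝ} (h0 : 0 ≤ θ) (h1 : θ ≤ 1) {a b : ℕ} (hab : b ≤ a) (k : ℕ) : θ ^ (a * k) ≤ θ ^ (b * k) :=
  pow_le_pow_of_le_one h0 h1 (Nat.mul_le_mul_right k hab)

/-- **CASE A's RATE**: `0 ≤ A` ⟹ `A·(1+k)·θ^{42k} ≤ A·(1−θ)⁻¹·θ^{38k}`. [folklore] -/
theorem rate_caseA {θ A : ℝ} (h0 : 0 ≤ θ) (h1 : θ < 1) (hA : 0 ≤ A) (k : ℕ) :
    A * (1 + (k : ℝ)) * θ ^ (42 * k) ≤ A * (1 - θ)⁻¹ * θ ^ (38 * k) := by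
  have hD := one_add_mul_pow_le h0 h1 k
  have h41 : θ ^ (41 * k) ≤ θ ^ (38 * k) := pow_le_pow_mul_of_le h0 h1.le (by norm_num) k
  have hsplit : θ ^ (42 * k) = θ ^ k * θ ^ (41 * k) := by rw [← pow_add]; congr 1; ring
  have h41' : 0 ≤ θ ^ (41 * k) := pow_nonneg h0 _
  have hD0 : 0 ≤ (1 - θ)⁻¹ := inv_nonneg.mpr (by linarith)
  rw [hsplit]
  calc A * (1 + (k : ℝ)) * (θ ^ k * θ ^ (41 * k)) = A * (((1 + (k : ℝ)) * θ ^ k) * θ ^ (41 * k)) := by ring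
    _ ≤ A * ((1 - θ)⁻¹ * θ ^ (38 * k)) := mul_le_mul_of_nonneg_left (mul_le_mul hD h41 h41' hD0) hA
    _ = A * (1 - θ)⁻¹ * θ ^ (38 * k) := by ring

/-- **CASE B's RATE**: `0 ≤ A` ⟹ `A·(1+k)³·θ^{54k} ≤ A·((1−θ)⁻¹)³·θ^{38k}`. [folklore] -/
theorem rate_caseB {θ A : ℝ} (h0 : 0 ≤ θ) (h1 : θ < 1) (hA : 0 ≤ A) (k : ℕ) :
    A * (1 + (k : ℝ)) ^ 3 * θ ^ (54 * k) ≤ A * ((1 - θ)⁻¹) ^ 3 * θ ^ (38 * k) := by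
  have hD := one_add_mul_pow_le h0 h1 k
  have hk0 : 0 ≤ (1 + (k : ℝ)) * θ ^ k := by positivity
  have hD3 : ((1 + (k : ℝ)) * θ ^ k) ^ 3 ≤ ((1 - θ)⁻¹) ^ 3 := pow_le_pow_left₀ hk0 hD 3
  have h51 : θ ^ (51 * k) ≤ θ ^ (38 * k) := pow_le_pow_mul_of_le h0 h1.le (by norm_num) k
  have hsplit : θ ^ (54 * k) = (θ ^ k) ^ 3 * θ ^ (51 * k) := by rw [← pow_mul, ← pow_add]; congr 1; ring
  have h51' : 0 ≤ θ ^ (51 * k) := pow_nonneg h0 _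
  have hD0 : 0 ≤ ((1 - θ)⁻¹) ^ 3 := pow_nonneg (inv_nonneg.mpr (by linarith)) 3
  rw [hsplit]
  calc A * (1 + (k : ℝ)) ^ 3 * ((θ ^ k) ^ 3 * θ ^ (51 * k)) = A * (((1 + (k : ℝ)) * θ ^ k) ^ 3 * θ ^ (51 * k)) := by ring
    _ ≤ A * (((1 - θ)⁻¹) ^ 3 * θ ^ (38 * k)) := mul_le_mul_of_nonneg_left (mul_le_mul hD3 h51 h51' hD0) hA
    _ = A * ((1 - θ)⁻¹) ^ 3 * θ ^ (38 * k) := by ring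

/-- **THE NORMAL PART's RATE**: `0 ≤ A, B` ⟹ `A·(1+k)·θ^{72k} + B·θ^{54k} ≤ (A·(1−θ)⁻¹ + B)·θ^{38k}`. [folklore] -/
theorem rate_normal {θ A B : ℝ} (h0 : 0 ≤ θ) (h1 : θ < 1) (hA : 0 ≤ A) (hB : 0 ≤ B) (k : ℕ) :
    A * (1 + (k : ℝ)) * θ ^ (72 * k) + B * θ ^ (54 * k) ≤ (A * (1 - θ)⁻¹ + B) * θ ^ (38 * k) := by
  have hD := one_add_mul_pow_le h0 h1 k
  have h71 : θ ^ (71 * k) ≤ θ ^ (38 * k) := pow_le_pow_mul_of_le h0 h1.le (by norm_num) k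
  have h54 : θ ^ (54 * k) ≤ θ ^ (38 * k) := pow_le_pow_mul_of_le h0 h1.le (by norm_num) k
  have hsplit : θ ^ (72 * k) = θ ^ k * θ ^ (71 * k) := by rw [← pow_add]; congr 1; ring
  have h71' : 0 ≤ θ ^ (71 * k) := pow_nonneg h0 _
  have hD0 : 0 ≤ (1 - θ)⁻¹ := inv_nonneg.mpr (by linarith)
  rw [hsplit]
  have t1 : A * (1 + (k : ℝ)) * (θ ^ k * θ ^ (71 * k)) ≤ A * (1 - θ)⁻¹ * θ ^ (38 * k) := by
    calc A * (1 + (k : ℝ)) * (θ ^ k * θ ^ (71 * k)) = A * (((1 + (k : ℝ)) * θ ^ k) * θ ^ (71 * k)) := by ring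
      _ ≤ A * ((1 - θ)⁻¹ * θ ^ (38 * k)) := mul_le_mul_of_nonneg_left (mul_le_mul hD h71 h71' hD0) hA
      _ = A * (1 - θ)⁻¹ * θ ^ (38 * k) := by ring
  have t2 : B * θ ^ (54 * k) ≤ B * θ ^ (38 * k) := mul_le_mul_of_nonneg_left h54 hB
  linarith

/-- **A PLAIN RATE**: `0 ≤ A`, `38 ≤ a` ⟹ `A·θ^{a k} ≤ A·θ^{38k}`. [folklore] -/
theorem rate_plain {θ A : ℝ} (h0 : 0 ≤ θ) (h1 : θ ≤ 1) (hA : 0 ≤ A) {a : ℕ} (ha : 38 ≤ a) (k : ℕ) :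
    A * θ ^ (a * k) ≤ A * θ ^ (38 * k) :=
  mul_le_mul_of_nonneg_left (pow_le_pow_mul_of_le h0 h1 ha k) hA

/-! ## §3 The same rates with a parametric target exponent (gen 108, log-tolerant supplier: (10) TYPE up to a logarithm)

A (10)-TYPE letter carrying the CZ∕junction logarithm, `‖∇_U F‖ ≤ c(1+k)η³`, enters the curl's Lipschitz constant as `c(2+k)`; the one-level theorem is
therefore run at the target exponent `40` (three spare powers of `θ` remain in every case) and the factor `(2+k)²` of the constant is exchanged against
`θ^{2k}` afterwards (`sq_two_add_rate`). -/

/-- **CASE A's RATE, parametric**: `b ≤ 41`, `0 ≤ A` ⟹ `A·(1+k)·θ^{42k} ≤ A·(1−θ)⁻¹·θ^{bk}`. [folklore] -/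
theorem rate_caseA_le {θ A : ℝ} (h0 : 0 ≤ θ) (h1 : θ < 1) (hA : 0 ≤ A) {b : ℕ} (hb : b ≤ 41) (k : ℕ) :
    A * (1 + (k : ℝ)) * θ ^ (42 * k) ≤ A * (1 - θ)⁻¹ * θ ^ (b * k) := by
  have hD := one_add_mul_pow_le h0 h1 k
  have h41 : θ ^ (41 * k) ≤ θ ^ (b * k) := pow_le_pow_mul_of_le h0 h1.le hb k
  have hsplit : θ ^ (42 * k) = θ ^ k * θ ^ (41 * k) := by rw [← pow_add]; congr 1; ring
  have h41' : 0 ≤ θ ^ (41 * k) := pow_nonneg h0 _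
  have hD0 : 0 ≤ (1 - θ)⁻¹ := inv_nonneg.mpr (by linarith)
  rw [hsplit]
  calc A * (1 + (k : ℝ)) * (θ ^ k * θ ^ (41 * k)) = A * (((1 + (k : ℝ)) * θ ^ k) * θ ^ (41 * k)) := by ring
    _ ≤ A * ((1 - θ)⁻¹ * θ ^ (b * k)) := mul_le_mul_of_nonneg_left (mul_le_mul hD h41 h41' hD0) hA
    _ = A * (1 - θ)⁻¹ * θ ^ (b * k) := by ring

/-- **CASE B's RATE, parametric**: `b ≤ 51`, `0 ≤ A` ⟹ `A·(1+k)³·θ^{54k} ≤ A·((1−θ)⁻¹)³·θ^{bk}`. [folklore] -/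
theorem rate_caseB_le {θ A : ℝ} (h0 : 0 ≤ θ) (h1 : θ < 1) (hA : 0 ≤ A) {b : ℕ} (hb : b ≤ 51) (k : ℕ) :
    A * (1 + (k : ℝ)) ^ 3 * θ ^ (54 * k) ≤ A * ((1 - θ)⁻¹) ^ 3 * θ ^ (b * k) := by
  have hD := one_add_mul_pow_le h0 h1 k
  have hk0 : 0 ≤ (1 + (k : ℝ)) * θ ^ k := by positivity
  have hD3 : ((1 + (k : ℝ)) * θ ^ k) ^ 3 ≤ ((1 - θ)⁻¹) ^ 3 := pow_le_pow_left₀ hk0 hD 3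
  have h51 : θ ^ (51 * k) ≤ θ ^ (b * k) := pow_le_pow_mul_of_le h0 h1.le hb k
  have hsplit : θ ^ (54 * k) = (θ ^ k) ^ 3 * θ ^ (51 * k) := by rw [← pow_mul, ← pow_add]; congr 1; ring
  have h51' : 0 ≤ θ ^ (51 * k) := pow_nonneg h0 _
  have hD0 : 0 ≤ ((1 - θ)⁻¹) ^ 3 := pow_nonneg (inv_nonneg.mpr (by linarith)) 3
  rw [hsplit]
  calc A * (1 + (k : ℝ)) ^ 3 * ((θ ^ k) ^ 3 * θ ^ (51 * k)) = A * (((1 + (k : ℝ)) * θ ^ k) ^ 3 * θ ^ (51 * k)) := by ring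
    _ ≤ A * (((1 - θ)⁻¹) ^ 3 * θ ^ (b * k)) := mul_le_mul_of_nonneg_left (mul_le_mul hD3 h51 h51' hD0) hA
    _ = A * ((1 - θ)⁻¹) ^ 3 * θ ^ (b * k) := by ring

/-- **THE NORMAL PART's RATE, parametric**: `b ≤ 54`, `0 ≤ A, B` ⟹ `A·(1+k)·θ^{72k} + B·θ^{54k} ≤ (A·(1−θ)⁻¹ + B)·θ^{bk}`. [folklore] -/
theorem rate_normal_le {θ A B : ℝ} (h0 : 0 ≤ θ) (h1 : θ < 1) (hA : 0 ≤ A) (hB : 0 ≤ B) {b : ℕ} (hb : b ≤ 54) (k : ℕ) :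
    A * (1 + (k : ℝ)) * θ ^ (72 * k) + B * θ ^ (54 * k) ≤ (A * (1 - θ)⁻¹ + B) * θ ^ (b * k) := by
  have hD := one_add_mul_pow_le h0 h1 k
  have h71 : θ ^ (71 * k) ≤ θ ^ (b * k) := pow_le_pow_mul_of_le h0 h1.le (by omega) k
  have h54 : θ ^ (54 * k) ≤ θ ^ (b * k) := pow_le_pow_mul_of_le h0 h1.le hb k
  have hsplit : θ ^ (72 * k) = θ ^ k * θ ^ (71 * k) := by rw [← pow_add]; congr 1; ring
  have h71' : 0 ≤ θ ^ (71 * k) := pow_nonneg h0 _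
  have hD0 : 0 ≤ (1 - θ)⁻¹ := inv_nonneg.mpr (by linarith)
  rw [hsplit]
  have t1 : A * (1 + (k : ℝ)) * (θ ^ k * θ ^ (71 * k)) ≤ A * (1 - θ)⁻¹ * θ ^ (b * k) := by
    calc A * (1 + (k : ℝ)) * (θ ^ k * θ ^ (71 * k)) = A * (((1 + (k : ℝ)) * θ ^ k) * θ ^ (71 * k)) := by ring
      _ ≤ A * ((1 - θ)⁻¹ * θ ^ (b * k)) := mul_le_mul_of_nonneg_left (mul_le_mul hD h71 h71' hD0) hA
      _ = A * (1 - θ)⁻¹ * θ ^ (b * k) := by ring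
  have t2 : B * θ ^ (54 * k) ≤ B * θ ^ (b * k) := mul_le_mul_of_nonneg_left h54 hB
  linarith

/-- **THE LOGARITHM OF (10) TYPE AGAINST TWO POWERS OF `θ`**: `0 ≤ A`, `k ≥ 1` not needed: `A·(2+k)²·θ^{40k} ≤ 4A·((1−θ)⁻¹)²·θ^{38k}`
(`2 + k ≤ 2(1+k)`, `((1+k)θ^k)² ≤ D²`). [folklore] -/
theorem sq_two_add_rate {θ A : ℝ} (h0 : 0 ≤ θ) (h1 : θ < 1) (hA : 0 ≤ A) (k : ℕ) :
    A * (2 + (k : ℝ)) ^ 2 * θ ^ (40 * k) ≤ 4 * A * ((1 - θ)⁻¹) ^ 2 * θ ^ (38 * k) := by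
  have hD := one_add_mul_pow_le h0 h1 k
  have hk0 : 0 ≤ (1 + (k : ℝ)) * θ ^ k := by positivity
  have hD2 : ((1 + (k : ℝ)) * θ ^ k) ^ 2 ≤ ((1 - θ)⁻¹) ^ 2 := pow_le_pow_left₀ hk0 hD 2
  have hsplit : θ ^ (40 * k) = (θ ^ k) ^ 2 * θ ^ (38 * k) := by rw [← pow_mul, ← pow_add]; congr 1; ring
  have h38 : 0 ≤ θ ^ (38 * k) := pow_nonneg h0 _
  have hk : (0 : ℝ) ≤ k := Nat.cast_nonneg k
  have h2k : (2 + (k : ℝ)) ^ 2 ≤ 4 * (1 + (k : ℝ)) ^ 2 := by nlinarith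
  rw [hsplit]
  calc A * (2 + (k : ℝ)) ^ 2 * ((θ ^ k) ^ 2 * θ ^ (38 * k))
      ≤ A * (4 * (1 + (k : ℝ)) ^ 2) * ((θ ^ k) ^ 2 * θ ^ (38 * k)) :=
        mul_le_mul_of_nonneg_right (mul_le_mul_of_nonneg_left h2k hA) (by positivity)
    _ = 4 * A * (((1 + (k : ℝ)) * θ ^ k) ^ 2 * θ ^ (38 * k)) := by ring
    _ ≤ 4 * A * (((1 - θ)⁻¹) ^ 2 * θ ^ (38 * k)) := mul_le_mul_of_nonneg_left (mul_le_mul_of_nonneg_right hD2 h38) (by positivity)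
    _ = 4 * A * ((1 - θ)⁻¹) ^ 2 * θ ^ (38 * k) := by ring

end Summit.QuantumFields.BalabanUV.T4Continuum.NE7CovGradBootstrapAlgebra
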